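/-
  HodgeLocusCensusUnitColumnRankFirstExceptionAllDegrees.lean — pub-hlocus ENGINE B (ivhs-2, gen 54), PROBE 14 (successor material, R-L561 (f) / R-L571 (b)).
  certified instances and evidence bearing on the general Hodge conjecture; no claim.

  KERNEL RANK THEOREMS (evidence class; no census number changes; nothing about HC). THE FIRST EXCEPTION OF EVERY PRIME AT EVERY DEGREE:
  anchor 271 `…UnitColumnRankFirstException` proved (EP) — over every field of characteristic `p` (prime) and `k ≥ p + 1`, the multiplicity matrix of
  `×q^{p−1}` on `K[x₁,…,x_k]/(xᵢ²)` (`d = 3`, level `j = 1`) has rank `k − 1`, one below THEOREM L's characteristic-`0` value `k`. This file proves the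
  same one-unit drop at EVERY degree `d = e + 3` at the level `j = e + 1` (`rank_mulDeltaPow_levels_first_exception`): for anchor 229's matrix VERBATIM
  at `c := p − 1`, `j := e + 1`,   rank + 1 = (anchor 229's λ-sum VERBATIM at `c := p − 1`, `j := e + 1`),   i.e. `rank_p = (THEOREM L's value) − 1`.
  MECHANISM (anchor 230's block decomposition `rank_mulDeltaPow_levels_eq_sum`, valid over every field): at `j = e + 1` the zero label `μ = 0` has
  `t = 1` on all `k` points and contributes `(p−1)! • W_{1,p}(k)` — rank `k − 1` by the POINT RULE (P0) of `…UnitColumnRankFirstException`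
  (`1 + (p − 1) = p = 0` in `K`, `(p−1)!` a unit), against THEOREM L's term `min (C(k,1), C(k,p)) = k` (`le_choose_of_le`); every NONZERO feasible
  label has block size `t = 0` (`t_eq_zero_of_ne`: `Σμ ≤ e·s < (e+1)s`) and contributes the all-ones block `(p−1)! • W_{0,p−1}(k − s)` whose rank is
  `min (C(k−s,0), C(k−s,p−1))` over EVERY field (`rank_incl_empty`) — exactly THEOREM L's term. So the census rank in characteristic `p` differs
  from THEOREM L's value by exactly the one unit lost on the zero label; at `e = 0` this is (EP) again (there the nonzero labels are absent).
  Instances: `p = 2`: rank M(k, e, 1, e+1) = L − 1 for k ≥ 3 (d = 3: anchor 230's (L2) at j = 1); `p = 3`, `d = 3`: (N3) of `…UnitColumnRankD3Deficit`.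
  Tools: `sum_add_one_eq_sum` (two finite ℕ-sums differing by one at one index), `card_label_zero` / `sum_label_le` / `card_support_pos` (label
  bookkeeping as in anchors 222/229/230), `le_choose_of_le` (`k ≤ C(k,p)` for `1 ≤ p ≤ k − 1`, via `Nat.add_one_mul_choose_eq`).
  By name: `colR` (174); 230's `rank_mulDeltaPow_levels_eq_sum`; 220's `rank_smul_of_ne_zero`; `…UnitColumnRankD3Deficit`'s
  `card_le_rank_add_card_of_single_mem_sup`; `…UnitColumnRankFirstException`'s `rank_incl_point_of_cast_eq_zero` (P0). 8 theorems, 0 defs; no sorries, axioms, instances or notation.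
-/
import Mathlib
import Summits.HodgeConjecture.HodgeConjecture.Theorems.HodgeLocusCensusUnitColumnRankFirstException

set_option linter.dupNamespace false
set_option autoImplicit false

namespace Summit.HodgeConjecture.HodgeConjecture.HodgeLocus.Census.UnitColumnRankFirstExceptionAllDegrees

open Summit.HodgeConjecture.HodgeConjecture.HodgeLocus.Census.ModelNonJumpC1All (colR)
open Summit.HodgeConjecture.HodgeConjecture.HodgeLocus.Census.UnitColumnRankLevelsChar (rank_mulDeltaPow_levels_eq_sum)
open Summit.HodgeConjecture.HodgeConjecture.HodgeLocus.Census.UnitColumnRankD3LevelsPowers (rank_smul_of_ne_zero)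
open Summit.HodgeConjecture.HodgeConjecture.HodgeLocus.Census.UnitColumnRankD3Deficit (card_le_rank_add_card_of_single_mem_sup)
open Summit.HodgeConjecture.HodgeConjecture.HodgeLocus.Census.UnitColumnRankFirstException (rank_incl_point_of_cast_eq_zero)
open Matrix Module

/-! ## Arithmetic of labels and binomials -/

/-- a finite sum exceeds another by exactly one at one index -/
theorem sum_add_one_eq_sum {ι : Type*} [Fintype ι] [DecidableEq ι] (f g : ι → ℕ) (a : ι) (ha : f a + 1 = g a)
    (h : ∀ i, i ≠ a → f i = g i) : (∑ i, f i) + 1 = ∑ i, g i := by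
  have hf := Finset.add_sum_erase Finset.univ f (Finset.mem_univ a)
  have hg := Finset.add_sum_erase Finset.univ g (Finset.mem_univ a)
  have hc : ∑ i ∈ Finset.univ.erase a, f i = ∑ i ∈ Finset.univ.erase a, g i :=
    Finset.sum_congr rfl (fun i hi => h i (Finset.ne_of_mem_erase hi))
  omega

/-- the number of label-zero points is `k − s` (as in anchors 222/229/230) -/
theorem card_label_zero {k e : ℕ} (μ : Fin k → Fin (e + 1)) :
    Fintype.card {x : Fin k // (μ x : ℕ) = 0} = k - (Finset.univ.filter (fun l => (μ l : ℕ) ≠ 0)).card := by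
  have h' := Finset.card_filter_add_card_filter_not (s := (Finset.univ : Finset (Fin k))) (fun l => (μ l : ℕ) = 0)
  rw [Fintype.card_subtype]
  simp only [Finset.card_univ, Fintype.card_fin, ne_eq] at h' ⊢
  omega

/-- the label sum is at most `e` times the support size -/
theorem sum_label_le {k e : ℕ} (μ : Fin k → Fin (e + 1)) :
    (∑ i, (μ i : ℕ)) ≤ e * (Finset.univ.filter (fun l => (μ l : ℕ) ≠ 0)).card := by
  rw [← Finset.sum_filter_ne_zero, mul_comm]
  have h := Finset.sum_le_card_nsmul (Finset.univ.filter (fun l => (μ l : ℕ) ≠ 0)) (fun l => (μ l : ℕ)) e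
    (fun l _ => Nat.lt_succ_iff.mp (μ l).2)
  rwa [smul_eq_mul] at h

/-- a nonzero label has nonempty support -/
theorem card_support_pos {k e : ℕ} (μ : Fin k → Fin (e + 1)) (hμ : μ ≠ fun _ => 0) :
    1 ≤ (Finset.univ.filter (fun l => (μ l : ℕ) ≠ 0)).card := by
  obtain ⟨l, hl⟩ := Function.ne_iff.mp hμ
  exact Finset.card_pos.mpr ⟨l, Finset.mem_filter.mpr ⟨Finset.mem_univ l, fun h => hl (Fin.ext (by rw [h, Fin.val_zero]))⟩⟩

/-- THE BLOCK SIZE OF A NONZERO FEASIBLE LABEL at level `j = e + 1` is `t = 0` -/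
theorem t_eq_zero_of_ne {k e : ℕ} (μ : Fin k → Fin (e + 1)) (hμ : μ ≠ fun _ => 0) :
    ((e + 1) + ∑ i, (μ i : ℕ)) / (e + 1) - (Finset.univ.filter (fun l => (μ l : ℕ) ≠ 0)).card = 0 := by
  have hs := card_support_pos μ hμ
  have hsum := sum_label_le μ
  have hlt : ((e + 1) + ∑ i, (μ i : ℕ)) / (e + 1) < (Finset.univ.filter (fun l => (μ l : ℕ) ≠ 0)).card + 1 := by
    rw [Nat.div_lt_iff_lt_mul (Nat.succ_pos e)]
    nlinarith [hs, hsum]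
  omega

/-- `k ≤ C(k, p)` for `1 ≤ p ≤ k − 1` -/
theorem le_choose_of_le (k p : ℕ) (h1 : 1 ≤ p) (h2 : p + 1 ≤ k) : k ≤ k.choose p := by
  obtain ⟨p', rfl⟩ : ∃ p', p = p' + 1 := ⟨p - 1, by omega⟩
  obtain ⟨k', rfl⟩ : ∃ k', k = k' + 1 := ⟨k - 1, by omega⟩
  have hmul := Nat.add_one_mul_choose_eq k' p'
  have hmono : (p' + 1).choose p' ≤ k'.choose p' := Nat.choose_le_choose p' (by omega)
  rw [Nat.choose_succ_self_right] at hmono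
  have : (k' + 1) * (p' + 1) ≤ (k' + 1).choose (p' + 1) * (p' + 1) := by
    rw [← hmul]; exact Nat.mul_le_mul_left _ hmono
  exact Nat.le_of_mul_le_mul_right this (Nat.succ_pos p')

/-! ## The empty-row inclusion block `W_{0,c}(α)` over any field -/

section Incl0

variable (K : Type*) [Field K] {α : Type*} [Fintype α] [DecidableEq α]

/-- `W_{0,c}(α)` is the all-ones `1 × C(|α|, c)` matrix: rank `min (C(|α|,0), C(|α|,0+c))` over every field. -/
theorem rank_incl_empty (t c : ℕ) (ht : t = 0) :
    (Matrix.of fun (T : {S : Finset α // S.card = t}) (U : {S : Finset α // S.card = t + c}) => if T.1 ⊆ U.1 then (1 : K) else 0).rank =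
      min ((Fintype.card α).choose t) ((Fintype.card α).choose (t + c)) := by
  subst ht
  set A := (Matrix.of fun (T : {S : Finset α // S.card = 0}) (U : {S : Finset α // S.card = 0 + c}) =>
    if T.1 ⊆ U.1 then (1 : K) else 0) with hA
  have h1 : A.rank ≤ (Fintype.card α).choose 0 := by
    have h := Matrix.rank_le_card_height A; rwa [Fintype.card_finset_len] at h
  have h2 : A.rank ≤ (Fintype.card α).choose (0 + c) := by
    have h := Matrix.rank_le_card_width A; rwa [Fintype.card_finset_len] at h
  rw [Nat.choose_zero_right] at h1 ⊢
  by_cases hc : (Fintype.card α).choose (0 + c) = 0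
  · rw [hc]; omega
  · -- a column exists; it is the unit vector at the unique row `∅`
    have hne : Nonempty {S : Finset α // S.card = 0 + c} := by
      rw [← Fintype.card_pos_iff, Fintype.card_finset_len]; omega
    obtain ⟨U0⟩ := hne
    have hT : ∀ T : {S : Finset α // S.card = 0}, T = ⟨∅, Finset.card_empty⟩ := fun T => Subtype.ext (Finset.card_eq_zero.mp T.2)
    have hcol : ∀ T0 : {S : Finset α // S.card = 0}, (Pi.single T0 (1 : K) : {S : Finset α // S.card = 0} → K) = A.col U0 := by
      intro T0
      funext T
      rw [hT T, hT T0, Pi.single_eq_same, Matrix.col_apply, hA, Matrix.of_apply, if_pos (Finset.empty_subset _)]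
    have h3 : 1 ≤ A.rank := by
      have h := card_le_rank_add_card_of_single_mem_sup (ι := Empty) A (fun i => (Empty.elim i : {S : Finset α // S.card = 0} → K))
        (fun T0 => Submodule.mem_sup_left (by rw [hcol T0]; exact Submodule.subset_span ⟨U0, rfl⟩))
      rw [Fintype.card_finset_len, Nat.choose_zero_right] at h
      simpa only [Fintype.card_eq_zero, add_zero] using h
    omega

end Incl0

/-! ## The first exception of every prime at every degree `d = e + 3` -/

section Census

variable (K : Type*) [Field K]

/-- THE FIRST EXCEPTION OF EVERY PRIME AT EVERY DEGREE: in characteristic `p`, for `k ≥ p + 1` variables and every `e` (`d = e + 3`), the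
multiplicity matrix of `×q^{p−1}` from level `(e + 1) + (p − 1)(e + 1) = p(e + 1)` to level `j = e + 1` on `B = K[x₁,…,x_k]/(xᵢ^{e+2})` (anchor 229's
matrix VERBATIM at `c := p − 1`, `j := e + 1`) has rank EXACTLY ONE BELOW THEOREM L's characteristic-`0` value (anchor 229's λ-sum VERBATIM at
`c := p − 1`, `j := e + 1`): the label `μ = 0` contributes the block `(p−1)! • W_{1,p}(k points)` of rank `k − 1 < k = min (C(k,1), C(k,p))`
(the point rule (P0) of `…UnitColumnRankFirstException`), every other feasible label has `t = 0` (`t_eq_zero_of_ne`) and contributes the all-ones block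
`(p−1)! • W_{0,p−1}(k − s points)` of rank `min (1, C(k−s, p−1))` in every characteristic (`rank_incl_empty`). At `e = 0` this is (EP). -/
theorem rank_mulDeltaPow_levels_first_exception (p : ℕ) [CharP K p] (hp : p.Prime) (k e : ℕ) (hk : p + 1 ≤ k) :
    (Matrix.of fun (v : {v : Fin k → Fin (e + 2) // (∑ i, (v i : ℕ)) + (e + 1) = k * (e + 1)})
        (m : {m : Fin k → Fin (e + 2) // (∑ i, (m i : ℕ)) + ((e + 1) + (p - 1) * (e + 1)) = k * (e + 1)}) =>
      ((((List.flatMap (colR (e + 3)))^[p - 1] [List.ofFn (fun i => (m.1 i : ℕ))]).count (List.ofFn (fun i => (v.1 i : ℕ))) : ℕ) : K)).rank + 1 =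
      ∑ μ : Fin k → Fin (e + 1),
        (if (e + 1) ∣ ((e + 1) + ∑ i, (μ i : ℕ)) ∧ (e + 1) * (Finset.univ.filter (fun l => (μ l : ℕ) ≠ 0)).card ≤ (e + 1) + ∑ i, (μ i : ℕ) then
            min ((k - (Finset.univ.filter (fun l => (μ l : ℕ) ≠ 0)).card).choose
                  (((e + 1) + ∑ i, (μ i : ℕ)) / (e + 1) - (Finset.univ.filter (fun l => (μ l : ℕ) ≠ 0)).card))
              ((k - (Finset.univ.filter (fun l => (μ l : ℕ) ≠ 0)).card).choose
                  (((e + 1) + ∑ i, (μ i : ℕ)) / (e + 1) - (Finset.univ.filter (fun l => (μ l : ℕ) ≠ 0)).card + (p - 1)))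
          else 0) := by
  have h2 := hp.two_le
  have hfact : (((p - 1).factorial : ℕ) : K) ≠ 0 := by
    rw [Ne, CharP.cast_eq_zero_iff K p, hp.dvd_factorial]; omega
  rw [rank_mulDeltaPow_levels_eq_sum K k e (p - 1) (e + 1)]
  set μ0 : Fin k → Fin (e + 1) := fun _ => 0 with hμ0
  refine sum_add_one_eq_sum _ _ μ0 ?_ ?_
  · -- the label `μ = 0`: `t = 1`, all `k` points, block `(p−1)! • W_{1,p}` of rank `k − 1`; THEOREM L's term is `min (C(k,1), C(k,p)) = k`
    have h1p : 1 + (p - 1) = p := by omega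
    have h0i : ∀ i, (μ0 i : ℕ) = 0 := fun i => by simp [hμ0]
    have hsum : (∑ i, (μ0 i : ℕ)) = 0 := Finset.sum_eq_zero (fun i _ => h0i i)
    have hfilter : (Finset.univ.filter (fun l => (μ0 l : ℕ) ≠ 0)) = ∅ :=
      Finset.filter_eq_empty_iff.mpr (fun l _ => by rw [h0i l]; omega)
    have hcond : (e + 1) ∣ ((e + 1) + ∑ i, (μ0 i : ℕ)) ∧ (e + 1) * (Finset.univ.filter (fun l => (μ0 l : ℕ) ≠ 0)).card ≤ (e + 1) + ∑ i, (μ0 i : ℕ) := by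
      rw [hsum, hfilter, Finset.card_empty]; exact ⟨dvd_refl _, by omega⟩
    have ht : ((e + 1) + ∑ i, (μ0 i : ℕ)) / (e + 1) - (Finset.univ.filter (fun l => (μ0 l : ℕ) ≠ 0)).card = 1 := by
      rw [hsum, hfilter, Finset.card_empty, Nat.add_zero, Nat.sub_zero, Nat.div_self (Nat.succ_pos e)]
    have hα : Fintype.card {x : Fin k // (μ0 x : ℕ) = 0} = k := by
      rw [card_label_zero, hfilter, Finset.card_empty, Nat.sub_zero]
    rw [if_pos hcond, if_pos hcond, rank_smul_of_ne_zero _ _ hfact,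
      rank_incl_point_of_cast_eq_zero K _ (p - 1) ht (by rw [hα]; omega) (by rw [ht, h1p]; exact CharP.cast_eq_zero K p),
      hα, ht, hfilter, Finset.card_empty, Nat.sub_zero, Nat.choose_one_right, h1p, min_eq_left (le_choose_of_le k p (by omega) hk)]
    omega
  · -- a nonzero label: `t = 0`, block `(p−1)! • W_{0,p−1}` of rank `min (1, C(k−s, p−1))` = THEOREM L's term
    intro μ hμ
    by_cases hcond : (e + 1) ∣ ((e + 1) + ∑ i, (μ i : ℕ)) ∧ (e + 1) * (Finset.univ.filter (fun l => (μ l : ℕ) ≠ 0)).card ≤ (e + 1) + ∑ i, (μ i : ℕ)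
    · rw [if_pos hcond, if_pos hcond, rank_smul_of_ne_zero _ _ hfact,
        rank_incl_empty K _ (p - 1) (t_eq_zero_of_ne μ (fun h => hμ (h.trans hμ0.symm))), card_label_zero]
    · rw [if_neg hcond, if_neg hcond]

end Census

end Summit.HodgeConjecture.HodgeConjecture.HodgeLocus.Census.UnitColumnRankFirstExceptionAllDegrees
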